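import Mathlib
import Summits.Ventures.PercRepro.TriangleCapFourBelowTen

/-!
# PercRepro — THE PAIR LEMMA OF THE DENSE CORNER (p3, gen 40; part 148)

Degree bounds for two vertices of a `K₄⁻`-free graph with `m ≥ 2k − 3` edges, the tools of the degree
argument of part 147 in general form:
* `deg_add_one_le_card` (`d(x) ≤ k − 1`), `deg_add_two_le_card_of_dense` (`3 (k − 1) < 2m` ⇒ `d(x) ≤ k − 2`: a
  dominating vertex forces `2m ≤ 3 (k − 1)`, part 126);
* `deg_add_deg_le_of_adj_k4m`: an ADJACENT pair has `d(x) + d(y) ≤ k + 1` (`codeg ≤ 1`);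
* **`deg_add_deg_add_six_le_of_not_adj`**: a NON-ADJACENT pair has `d(x) + d(y) ≤ 2k − 6` as soon as
  `m ≥ 2k − 3` — with `C = N(x) ∩ N(y)` (independent), `U = N(x) ∪ N(y) ⊆ Sᶜ` (`S = {x, y}`),
  `d(x) + d(y) = |U| + |C| ≤ (k − 2) + |C|`, and `2m = 2 (d(x) + d(y)) + Σ_{Sᶜ} degIn Sᶜ` where the edges inside
  `Sᶜ` all leave `C`: `d(x) + d(y) ≥ 2k − 5` forces `|C| ≥ k − 3`, at most one vertex `w` of `Sᶜ` outside `C`,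
  `m = d(x) + d(y) + degIn C w` (or `m = d(x) + d(y) ≤ 2k − 4` when `Sᶜ = C`), hence `d(x) + d(y) = 2k − 5`,
  `U = Sᶜ ∋ w`, `degIn C w ≥ 2`, and two common neighbours of `w` and `x` (or `y`) close a `K₄⁻`;
* `deg_add_deg_add_six_le`: any two distinct vertices, `k ≥ 7`, `m ≥ 2k − 3`.
Axioms: standard.
-/

namespace PercRepro

namespace TriangleCap

namespace C047

open Finset

variable {V : Type*} [Fintype V] [DecidableEq V]

omit [DecidableEq V] in
/-- `d(x) + 1 ≤ k`. -/
theorem deg_add_one_le_card (D : SimpleGraph V) [DecidableRel D.Adj] (x : V) :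
    deg D x + 1 ≤ Fintype.card V := by
  classical
  unfold deg
  have hsub : univ.filter (fun w => D.Adj x w) ⊆ univ.erase x := by
    intro w hw
    rw [mem_filter] at hw
    rw [mem_erase]
    exact ⟨hw.2.ne.symm, mem_univ w⟩
  have h1 := card_le_card hsub
  rw [card_erase_of_mem (mem_univ x), card_univ] at h1
  have h2 : 1 ≤ Fintype.card V := Fintype.card_pos_iff.mpr ⟨x⟩
  omega

/-- **NON-DOMINATION:** `3 (k − 1) < 2m` ⇒ `d(x) + 2 ≤ k` (a dominating vertex forces `2m ≤ 3 (k − 1)`). -/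
theorem deg_add_two_le_card_of_dense (D : SimpleGraph V) [DecidableRel D.Adj] (hK : K4mFree D)
    (hm : 3 * (Fintype.card V - 1) < 2 * D.edgeFinset.card) (x : V) : deg D x + 2 ≤ Fintype.card V := by
  have h1 := deg_add_one_le_card D x
  by_contra h
  push Not at h
  have hx : deg D x + 1 = Fintype.card V := by omega
  have := two_mul_card_edges_le_of_dominating D hK hx
  omega

/-- **AN ADJACENT PAIR:** `d(x) + d(y) ≤ k + 1` in a `K₄⁻`-free graph (`codeg ≤ 1`). -/
theorem deg_add_deg_le_of_adj_k4m (D : SimpleGraph V) [DecidableRel D.Adj] (hK : K4mFree D) {x y : V}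
    (hxy : D.Adj x y) : deg D x + deg D y ≤ Fintype.card V + 1 := by
  have h1 : deg D x + deg D y + deficit D (x, y) = Fintype.card V + codeg D (x, y) :=
    deg_add_deg_add_deficit D (x, y)
  have h2 : codeg D (x, y) ≤ 1 := codeg_le_one D hK ((mem_adjPairsAll D (x, y)).mpr hxy)
  omega

/-- **THE PAIR LEMMA:** in a `K₄⁻`-free graph with `m ≥ 2k − 3` edges, two NON-ADJACENT vertices have
`d(x) + d(y) ≤ 2k − 6`. -/
theorem deg_add_deg_add_six_le_of_not_adj (D : SimpleGraph V) [DecidableRel D.Adj] (hK : K4mFree D)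
    (hm : 2 * Fintype.card V ≤ D.edgeFinset.card + 3) {x y : V} (hne : x ≠ y) (hxy : ¬ D.Adj x y) :
    deg D x + deg D y + 6 ≤ 2 * Fintype.card V := by
  by_contra hcon
  push Not at hcon
  have hScard : ({x, y} : Finset V).card = 2 := card_pair hne
  have hk2 : 2 ≤ Fintype.card V := by
    have := card_le_univ ({x, y} : Finset V)
    omega
  obtain ⟨Nx, hNx⟩ : ∃ Nx : Finset V, Nx = univ.filter (fun v => D.Adj x v) := ⟨_, rfl⟩
  obtain ⟨Ny, hNy⟩ : ∃ Ny : Finset V, Ny = univ.filter (fun v => D.Adj y v) := ⟨_, rfl⟩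
  have hdx : deg D x = Nx.card := by rw [hNx]; rfl
  have hdy : deg D y = Ny.card := by rw [hNy]; rfl
  obtain ⟨C, hC⟩ : ∃ C : Finset V, C = Nx ∩ Ny := ⟨_, rfl⟩
  have hUC : (Nx ∪ Ny).card + C.card = Nx.card + Ny.card := by
    rw [hC]; exact card_union_add_card_inter Nx Ny
  -- the neighbourhoods avoid `x` and `y`
  have hsub : Nx ∪ Ny ⊆ ({x, y} : Finset V)ᶜ := by
    intro v hv
    rw [mem_union, hNx, hNy, mem_filter, mem_filter] at hv
    rw [mem_compl, mem_insert, mem_singleton]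
    intro h
    rcases h with h | h
    · rw [h] at hv
      rcases hv with ⟨-, h'⟩ | ⟨-, h'⟩
      · exact D.irrefl h'
      · exact hxy (D.adj_symm h')
    · rw [h] at hv
      rcases hv with ⟨-, h'⟩ | ⟨-, h'⟩
      · exact hxy h'
      · exact D.irrefl h'
  have hScompl : (({x, y} : Finset V)ᶜ).card + 2 = Fintype.card V := by
    rw [card_compl, hScard]; omega
  have hU : (Nx ∪ Ny).card + 2 ≤ Fintype.card V := by
    have := card_le_card hsub
    omega
  have hCS : C ⊆ ({x, y} : Finset V)ᶜ := by
    intro c hc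
    rw [hC, mem_inter] at hc
    exact hsub (mem_union_left _ hc.1)
  have hC8 : C.card + 2 ≤ Fintype.card V := by
    have := card_le_card hCS
    omega
  -- the common neighbours are independent (`K₄⁻`)
  have hCind : ∀ c ∈ C, ∀ c' ∈ C, ¬ D.Adj c c' := by
    intro c hc c' hc' hcc'
    rw [hC, mem_inter, hNx, hNy, mem_filter, mem_filter] at hc hc'
    exact not_adj_both D hK hcc' (D.adj_symm hc.1.2) (D.adj_symm hc'.1.2) hne (D.adj_symm hc.2.2)
      (D.adj_symm hc'.2.2)
  -- the degree sum through `S = {x, y}`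
  have hid := two_mul_card_edges_eq_adjPairs_add D {x, y}
  have hadj0 : adjPairs D ({x, y} : Finset V) = 0 := by
    unfold adjPairs
    rw [card_eq_zero, filter_eq_empty_iff]
    intro p hp
    rw [mem_product, mem_insert, mem_singleton, mem_insert, mem_singleton] at hp
    rcases hp with ⟨h1 | h1, h2 | h2⟩ <;> rw [h1, h2]
    · exact D.irrefl
    · exact hxy
    · exact fun h => hxy (D.adj_symm h)
    · exact D.irrefl
  have hout : ∑ z ∈ ({x, y} : Finset V)ᶜ, degIn D {x, y} z = deg D x + deg D y := by
    rw [sum_degIn_comm, sum_pair hne]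
    have e1 := deg_eq_degIn_add_degIn_compl D {x, y} x
    have e2 := deg_eq_degIn_add_degIn_compl D {x, y} y
    have z1 : degIn D ({x, y} : Finset V) x = 0 := by
      unfold degIn
      rw [card_eq_zero, filter_eq_empty_iff]
      intro v hv
      rw [mem_insert, mem_singleton] at hv
      rcases hv with h | h <;> rw [h]
      · exact D.irrefl
      · exact hxy
    have z2 : degIn D ({x, y} : Finset V) y = 0 := by
      unfold degIn
      rw [card_eq_zero, filter_eq_empty_iff]
      intro v hv
      rw [mem_insert, mem_singleton] at hv
      rcases hv with h | h <;> rw [h]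
      · exact fun h' => hxy (D.adj_symm h')
      · exact D.irrefl
    omega
  rw [hadj0, hout] at hid
  -- the edges inside `Sᶜ` through the independent set `C`
  have hsplit := sum_degIn_compl_split D {x, y} C hCS hCind
  have hT : ((({x, y} : Finset V)ᶜ) \ C).card + C.card + 2 = Fintype.card V := by
    rw [card_sdiff_of_subset hCS]
    have := card_le_card hCS
    omega
  have hT1 : ((({x, y} : Finset V)ᶜ) \ C).card ≤ 1 := by omega
  have hTT : ∑ w ∈ (({x, y} : Finset V)ᶜ) \ C, degIn D ((({x, y} : Finset V)ᶜ) \ C) w = 0 := by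
    apply sum_eq_zero
    intro w hw
    have := degIn_le_card_sub_one D hw
    omega
  rw [hTT] at hsplit
  rcases eq_empty_or_singleton_of_card_le_one hT1 with hTe | ⟨w, hTw⟩
  · rw [hTe, sum_empty] at hsplit
    omega
  · have hT1' : ((({x, y} : Finset V)ᶜ) \ C).card = 1 := by rw [hTw]; exact card_singleton w
    rw [hTw, sum_singleton] at hsplit
    have hw : w ∈ (({x, y} : Finset V)ᶜ) \ C := by rw [hTw]; exact mem_singleton_self w
    rw [mem_sdiff] at hw
    have hCw : 2 ≤ degIn D C w := by omega
    have hUeq : Nx ∪ Ny = ({x, y} : Finset V)ᶜ := eq_of_subset_of_card_le hsub (by omega)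
    have hwU : w ∈ Nx ∪ Ny := by rw [hUeq]; exact hw.1
    unfold degIn at hCw
    obtain ⟨c, hc, c', hc', hcc'⟩ := one_lt_card.mp hCw
    rw [mem_filter, hC, mem_inter, hNx, hNy, mem_filter, mem_filter] at hc hc'
    rw [mem_union, hNx, hNy, mem_filter, mem_filter] at hwU
    rcases hwU with ⟨-, hxw⟩ | ⟨-, hyw⟩
    · exact not_adj_both D hK hxw hc.1.1.2 hc.2 hcc' hc'.1.1.2 hc'.2
    · exact not_adj_both D hK hyw hc.1.2.2 hc.2 hcc' hc'.1.2.2 hc'.2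

/-- **ANY TWO DISTINCT VERTICES** of a `K₄⁻`-free graph with `k ≥ 7` and `m ≥ 2k − 3`: `d(x) + d(y) ≤ 2k − 6`. -/
theorem deg_add_deg_add_six_le (D : SimpleGraph V) [DecidableRel D.Adj] (hK : K4mFree D)
    (hk : 7 ≤ Fintype.card V) (hm : 2 * Fintype.card V ≤ D.edgeFinset.card + 3) {x y : V} (hne : x ≠ y) :
    deg D x + deg D y + 6 ≤ 2 * Fintype.card V := by
  by_cases hxy : D.Adj x y
  · have := deg_add_deg_le_of_adj_k4m D hK hxy
    omega
  · exact deg_add_deg_add_six_le_of_not_adj D hK hm hne hxy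

end C047

end TriangleCap

end PercRepro
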